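import Mathlib
import HarnessLib
import Summits.HubbardSuperconductivity.HubbardSuperconductivity.Theorems.KLProgrammeKLRegimeEngineTowerBookkeeping

/-!
# Route `KLProgramme` — crux K3 ENGINE (stmt-HubbardSuperconductivity-20437 `KLRegimeEngineV17F2`), stub (b): the blocked-tower bookkeeping,
# part 4 — the SHARP form: the imported degrees carry their `ε` (E1 lead r2d-p2 g5, memo E1-TOWER-BLOCKED §9)

Part 2 (`towerBorn_le_law`) merges the two imported degrees into the geometric profile of the recursive part (`μ k 1 ≤ A'Q'`), which prices a
two-leg insertion at `λ⁰` and therefore needs the amplitude condition `2A'ΦτQ' < 1`.  In the model the two-leg and the quartic inputs ARE `O(ε)`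
(memo §6), so here they keep their own constants — the THREE-PIECE profile `μ 1 ≤ ι₁λ`, `μ 2 ≤ ι₂λ`, `μ m ≤ A'λ^{m−1}Q'^m` (`m ≥ 3`) — and the
graded sum is bounded in CHERNOFF form:
* **`towerS_le_chernoff`** — `towerS D τ μ n p ≤ (w^{p−1})⁻¹·(Σ_{δ∈[1,D]} τ^δ μ(δ) w^{δ−1})ⁿ` for every `w ≥ 1`;
* `sum_threePiece_le` — at `w = (2τQ'λ)⁻¹`: `Σ_δ τ^δ μ(δ) w^{δ−1} ≤ τ·Y`, **`Y := ι₁λ + ι₂/(2Q') + A'Q'/2`**; `towerV_le_threePiece`;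
  `towerFO_le_of_three_le`;
* **`towerStep_le_profile₃`** (T2♯) — `b ≤ A'λ^{p−1}(4Q')^p x₁/(1−x₁) + e·λ^{p−1}·ψ(2τψQ')^{p−1}·τY·y/(1−y)`, **`y := ΦτY`**;
* **`towerBorn_le_law₃`** (T3♯) — the induction over blocks with `μ k 1 ≤ ι₁λ`, `μ k 2 ≤ ι₂λ` ⊢ `∀ k ≤ K, ∀ 3 ≤ p ≤ D, b k p ≤ Aλ^{p−1}Q^p`; the
  only `λ`-free smallness left is `Φτι₂/(2Q') < 1` inside `y < 1` (the law's per-vertex constant above the bare quartic tree's cost).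
Pure real analysis; nothing about the model is asserted.
-/

noncomputable section

namespace Summit.HubbardSuperconductivity.HubbardSuperconductivity.Theorems.EngineV8

set_option linter.dupNamespace false -- summit = problem name (single-conjunct summit), D-0017

open Real Finset

/-! ## §1 The graded sum in Chernoff form -/

/-- **Chernoff form of the graded sum**: for `w ≥ 1`, `0 ≤ τ`, `0 ≤ μ`,
`towerS D τ μ n p ≤ (w^{p−1})⁻¹ · (Σ_{δ ∈ [1,D]} τ^δ μ(δ) w^{δ−1})ⁿ` — on the constraint `p + n − 1 ≤ Σδ_a` (i.e. `p − 1 ≤ Σ(δ_a − 1)`) one has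
`1 ≤ w^{Σ(δ_a−1)}/w^{p−1}`, and the unconstrained product sum factorises. -/
theorem towerS_le_chernoff {D : ℕ} {τ w : ℝ} {μ : ℕ → ℝ} (hτ : 0 ≤ τ) (hμ0 : ∀ m, 0 ≤ μ m) (hw : 1 ≤ w) (n p : ℕ) :
    towerS D τ μ n p ≤ (w ^ (p - 1))⁻¹ * (∑ δ ∈ Icc 1 D, τ ^ δ * μ δ * w ^ (δ - 1)) ^ n := by
  have hw0 : 0 < w := one_pos.trans_le hw
  have hterm : ∀ δ ∈ (Fintype.piFinset fun _ : Fin n => Icc 1 D).filter (fun δ => p + n - 1 ≤ ∑ a, δ a),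
      ∏ a, τ ^ (δ a) * μ (δ a) ≤ (w ^ (p - 1))⁻¹ * ∏ a, τ ^ (δ a) * μ (δ a) * w ^ (δ a - 1) := by
    intro δ hδ
    rw [mem_filter, Fintype.mem_piFinset] at hδ
    obtain ⟨hδD, hc⟩ := hδ
    have hδ1 : ∀ a, 1 ≤ δ a := fun a => (mem_Icc.1 (hδD a)).1
    have hTS : ∑ a, (δ a - 1) + n = ∑ a, δ a := by
      have : ∑ a : Fin n, (δ a - 1) + ∑ _a : Fin n, 1 = ∑ a, δ a := by
        rw [← sum_add_distrib]; exact sum_congr rfl fun a _ => Nat.sub_add_cancel (hδ1 a)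
      rw [sum_const, card_univ, Fintype.card_fin, smul_eq_mul, mul_one] at this
      exact this
    have hT : p - 1 ≤ ∑ a, (δ a - 1) := by omega
    have hsplit : ∏ a, τ ^ (δ a) * μ (δ a) * w ^ (δ a - 1) = (∏ a, τ ^ (δ a) * μ (δ a)) * w ^ (∑ a, (δ a - 1)) := by
      rw [prod_mul_distrib, prod_pow_eq_pow_sum]
    have hP0 : 0 ≤ ∏ a, τ ^ (δ a) * μ (δ a) := prod_nonneg fun a _ => by have := hμ0 (δ a); positivity
    have hge : 1 ≤ w ^ (∑ a, (δ a - 1)) * (w ^ (p - 1))⁻¹ := by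
      rw [← div_eq_mul_inv, one_le_div (pow_pos hw0 _)]
      exact pow_le_pow_right₀ hw hT
    rw [hsplit]
    calc ∏ a, τ ^ (δ a) * μ (δ a) = (∏ a, τ ^ (δ a) * μ (δ a)) * 1 := (mul_one _).symm
      _ ≤ (∏ a, τ ^ (δ a) * μ (δ a)) * (w ^ (∑ a, (δ a - 1)) * (w ^ (p - 1))⁻¹) := mul_le_mul_of_nonneg_left hge hP0
      _ = _ := by ring
  unfold towerS
  refine (sum_le_sum hterm).trans ?_
  refine (sum_le_sum_of_subset_of_nonneg (filter_subset _ _) fun δ _ _ => ?_).trans ?_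
  · exact mul_nonneg (by positivity) (prod_nonneg fun a _ => by have := hμ0 (δ a); positivity)
  · rw [← mul_sum, ← (prod_univ_sum (fun _ : Fin n => Icc 1 D) (fun _ δ => τ ^ δ * μ δ * w ^ (δ - 1))), prod_const, card_univ,
      Fintype.card_fin]

/-! ## §2 The three-piece profile -/

/-- `Σ_{δ ∈ [1,D], 3 ≤ δ} (1/2)^{δ−1} ≤ 1/2`. -/
theorem sum_Icc_ite_half_pow_le (D : ℕ) :
    ∑ δ ∈ Icc 1 D, (if 3 ≤ δ then (1 / 2 : ℝ) ^ (δ - 1) else 0) ≤ 1 / 2 := by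
  rw [← sum_filter]
  have hI : (Icc 1 D).filter (fun δ => 3 ≤ δ) = Ico 3 (D + 1) := by
    ext δ; simp only [mem_filter, mem_Icc, mem_Ico]; omega
  rw [hI, sum_Ico_eq_sum_range]
  have h := geom_sum_Ico_le_of_lt_one (x := (1 / 2 : ℝ)) (by norm_num) (by norm_num) (m := 0) (n := D + 1 - 3)
  rw [pow_zero, ← range_eq_Ico] at h
  calc ∑ i ∈ range (D + 1 - 3), (1 / 2 : ℝ) ^ (3 + i - 1) = (1 / 2 : ℝ) ^ 2 * ∑ i ∈ range (D + 1 - 3), (1 / 2 : ℝ) ^ i := by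
        rw [mul_sum]; exact sum_congr rfl fun i _ => by rw [← pow_add]; congr 1; omega
    _ ≤ (1 / 2 : ℝ) ^ 2 * (1 / (1 - 1 / 2)) := mul_le_mul_of_nonneg_left h (by norm_num)
    _ = 1 / 2 := by norm_num

/-- **The Chernoff sum of the three-piece profile at `w = (2τQ'λ)⁻¹`**: with `μ 1 ≤ ι₁λ`, `μ 2 ≤ ι₂λ`, `μ m ≤ A'λ^{m−1}Q'^m` (`3 ≤ m ≤ D`) and
`0 < λ, τ, Q'`:  `Σ_{δ ∈ [1,D]} τ^δ μ(δ) w^{δ−1} ≤ τ·(ι₁λ + ι₂/(2Q') + A'Q'/2)` (the recursive inputs sum `Σ_{j ≥ 2} 2^{−j} = 1/2`). -/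
theorem sum_threePiece_le {D : ℕ} {τ lam Q' A' ι₁ ι₂ : ℝ} {μ : ℕ → ℝ} (hτ : 0 < τ) (hlam : 0 < lam) (hQ' : 0 < Q') (hA' : 0 ≤ A')
    (hμ0 : ∀ m, 0 ≤ μ m) (hι₁ : μ 1 ≤ ι₁ * lam) (hι₂ : μ 2 ≤ ι₂ * lam)
    (hprof : ∀ m, 3 ≤ m → m ≤ D → μ m ≤ A' * lam ^ (m - 1) * Q' ^ m) :
    ∑ δ ∈ Icc 1 D, τ ^ δ * μ δ * ((2 * τ * Q' * lam)⁻¹) ^ (δ - 1) ≤ τ * (ι₁ * lam + ι₂ / (2 * Q') + A' * Q' / 2) := by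
  set w : ℝ := (2 * τ * Q' * lam)⁻¹ with hwdef
  have hx0 : 0 < 2 * τ * Q' * lam := by positivity
  have hw0 : 0 < w := inv_pos.2 hx0
  have hι₁0 : 0 ≤ ι₁ * lam := (hμ0 1).trans hι₁
  have hι₂0 : 0 ≤ ι₂ * lam := (hμ0 2).trans hι₂
  have hι₂0' : 0 ≤ ι₂ := by
    by_contra h
    exact absurd hι₂0 (not_le.2 (mul_neg_of_neg_of_pos (not_le.1 h) hlam))
  -- termwise majorant
  set f : ℕ → ℝ := fun δ => (if 1 = δ then τ * (ι₁ * lam) else 0) + (if 2 = δ then τ * (ι₂ / (2 * Q')) else 0) +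
    τ * (A' * Q') * (if 3 ≤ δ then (1 / 2 : ℝ) ^ (δ - 1) else 0) with hf
  have hkey : ∀ δ, 3 ≤ δ → τ ^ δ * (lam ^ (δ - 1) * Q' ^ δ) * w ^ (δ - 1) = τ * Q' * (1 / 2 : ℝ) ^ (δ - 1) := by
    intro δ hδ
    obtain ⟨j, rfl⟩ : ∃ j, δ = j + 1 := ⟨δ - 1, by omega⟩
    rw [Nat.add_sub_cancel, hwdef, inv_pow, pow_succ, pow_succ, one_div, inv_pow]
    have h2 : (2 : ℝ) ^ j ≠ 0 := pow_ne_zero _ two_ne_zero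
    have : (2 * τ * Q' * lam) ^ j ≠ 0 := pow_ne_zero _ hx0.ne'
    field_simp
    rw [mul_pow, mul_pow, mul_pow]
    ring
  have hterm : ∀ δ ∈ Icc 1 D, τ ^ δ * μ δ * w ^ (δ - 1) ≤ f δ := by
    intro δ hδ
    have hδ1 := (mem_Icc.1 hδ).1
    rw [hf]
    dsimp only
    rcases Nat.lt_or_ge δ 3 with h3 | h3
    · interval_cases δ
      · simp only [if_true, show ¬ (2 : ℕ) = 1 by decide, if_false, show ¬ 3 ≤ 1 by decide, pow_one, Nat.sub_self, pow_zero, mul_one,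
          add_zero, mul_zero]
        exact mul_le_mul_of_nonneg_left hι₁ hτ.le
      · simp only [show ¬ (1 : ℕ) = 2 by decide, if_false, if_true, show ¬ 3 ≤ 2 by decide, zero_add, add_zero, mul_zero,
          show 2 - 1 = 1 from rfl, pow_one]
        calc τ ^ 2 * μ 2 * w ≤ τ ^ 2 * (ι₂ * lam) * w := by gcongr
          _ = τ * (ι₂ / (2 * Q')) := by rw [hwdef]; field_simp
    · rw [if_neg (by omega), if_neg (by omega), if_pos h3, zero_add, zero_add]
      calc τ ^ δ * μ δ * w ^ (δ - 1) ≤ τ ^ δ * (A' * lam ^ (δ - 1) * Q' ^ δ) * w ^ (δ - 1) := by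
            have := hprof δ h3 (mem_Icc.1 hδ).2; gcongr
        _ = A' * (τ ^ δ * (lam ^ (δ - 1) * Q' ^ δ) * w ^ (δ - 1)) := by ring
        _ = τ * (A' * Q') * (1 / 2 : ℝ) ^ (δ - 1) := by rw [hkey δ h3]; ring
  refine (sum_le_sum hterm).trans ?_
  -- sum the majorant
  rw [hf, sum_add_distrib, sum_add_distrib, sum_ite_eq, sum_ite_eq, ← mul_sum]
  have h1 : (if 1 ∈ Icc 1 D then τ * (ι₁ * lam) else 0) ≤ τ * (ι₁ * lam) := by
    split_ifs
    · exact le_rfl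
    · positivity
  have h2 : (if 2 ∈ Icc 1 D then τ * (ι₂ / (2 * Q')) else 0) ≤ τ * (ι₂ / (2 * Q')) := by
    split_ifs
    · exact le_rfl
    · positivity
  have h3 : τ * (A' * Q') * ∑ δ ∈ Icc 1 D, (if 3 ≤ δ then (1 / 2 : ℝ) ^ (δ - 1) else 0) ≤ τ * (A' * Q') * (1 / 2) :=
    mul_le_mul_of_nonneg_left (sum_Icc_ite_half_pow_le D) (by positivity)
  calc _ ≤ τ * (ι₁ * lam) + τ * (ι₂ / (2 * Q')) + τ * (A' * Q') * (1 / 2) := add_le_add_three h1 h2 h3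
    _ = τ * (ι₁ * lam + ι₂ / (2 * Q') + A' * Q' / 2) := by ring

/-- `Σ_{m ∈ [1,D], 3 ≤ m} x^{m−1} ≤ x²/(1−x)` for `0 ≤ x < 1`. -/
theorem sum_Icc_ite_pow_le {x : ℝ} (hx0 : 0 ≤ x) (hx1 : x < 1) (D : ℕ) :
    ∑ m ∈ Icc 1 D, (if 3 ≤ m then x ^ (m - 1) else 0) ≤ x ^ 2 / (1 - x) := by
  rw [← sum_filter]
  have hI : (Icc 1 D).filter (fun m => 3 ≤ m) = Ico 3 (D + 1) := by
    ext m; simp only [mem_filter, mem_Icc, mem_Ico]; omega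
  rw [hI]
  have h := geom_sum_Ico_le_of_lt_one hx0 hx1 (m := 2) (n := D)
  refine le_trans (le_of_eq ?_) h
  have hI2 : Ico 3 (D + 1) = image (· + 1) (Ico 2 D) := by
    ext m; simp only [mem_Ico, mem_image]; constructor
    · intro hm; exact ⟨m - 1, by omega, by omega⟩
    · rintro ⟨a, ha, rfl⟩; omega
  rw [hI2, sum_image fun a _ b _ h => by omega]
  exact sum_congr rfl fun a _ => by rw [Nat.add_sub_cancel]

/-- **The field-weighted norm of the three-piece profile**: `towerV D τ μ ≤ eτ·ι₁λ + (eτ)²·ι₂λ + A'·eτQ'·x₃²/(1−x₃)`, `x₃ = eτλQ' < 1`. -/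
theorem towerV_le_threePiece {D : ℕ} {τ lam Q' A' ι₁ ι₂ : ℝ} {μ : ℕ → ℝ} (hτ : 0 ≤ τ) (hlam : 0 ≤ lam) (hQ' : 0 ≤ Q') (hA' : 0 ≤ A')
    (hμ0 : ∀ m, 0 ≤ μ m) (hι₁ : μ 1 ≤ ι₁ * lam) (hι₂ : μ 2 ≤ ι₂ * lam)
    (hprof : ∀ m, 3 ≤ m → m ≤ D → μ m ≤ A' * lam ^ (m - 1) * Q' ^ m) (hx₃ : exp 1 * τ * lam * Q' < 1) :
    towerV D τ μ ≤ exp 1 * τ * (ι₁ * lam) + (exp 1 * τ) ^ 2 * (ι₂ * lam) +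
      A' * (exp 1 * τ * Q') * ((exp 1 * τ * lam * Q') ^ 2 / (1 - exp 1 * τ * lam * Q')) := by
  have hx0 : 0 ≤ exp 1 * τ * lam * Q' := by positivity
  have hι₁0 : 0 ≤ ι₁ * lam := (hμ0 1).trans hι₁
  have hι₂0 : 0 ≤ ι₂ * lam := (hμ0 2).trans hι₂
  set f : ℕ → ℝ := fun m => (if 1 = m then exp 1 * τ * (ι₁ * lam) else 0) + (if 2 = m then (exp 1 * τ) ^ 2 * (ι₂ * lam) else 0) +
    A' * (exp 1 * τ * Q') * (if 3 ≤ m then (exp 1 * τ * lam * Q') ^ (m - 1) else 0) with hf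
  have hterm : ∀ m ∈ Icc 1 D, (exp 1 * τ) ^ m * μ m ≤ f m := by
    intro m hm
    have hm1 := (mem_Icc.1 hm).1
    rw [hf]
    dsimp only
    rcases Nat.lt_or_ge m 3 with h3 | h3
    · interval_cases m
      · simp only [if_true, show ¬ (2 : ℕ) = 1 by decide, if_false, show ¬ 3 ≤ 1 by decide, pow_one, add_zero, mul_zero]
        exact mul_le_mul_of_nonneg_left hι₁ (by positivity)
      · simp only [show ¬ (1 : ℕ) = 2 by decide, if_false, if_true, show ¬ 3 ≤ 2 by decide, zero_add, add_zero, mul_zero]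
        exact mul_le_mul_of_nonneg_left hι₂ (by positivity)
    · rw [if_neg (by omega), if_neg (by omega), if_pos h3, zero_add, zero_add]
      calc (exp 1 * τ) ^ m * μ m ≤ (exp 1 * τ) ^ m * (A' * lam ^ (m - 1) * Q' ^ m) := by
            have := hprof m h3 (mem_Icc.1 hm).2; have := hμ0 m; gcongr
        _ = A' * (exp 1 * τ * Q') * (exp 1 * τ * lam * Q') ^ (m - 1) := by
            obtain ⟨j, rfl⟩ : ∃ j, m = j + 1 := ⟨m - 1, by omega⟩
            simp only [Nat.add_sub_cancel, pow_succ, mul_pow]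
            ring
  unfold towerV
  refine (sum_le_sum hterm).trans ?_
  rw [hf, sum_add_distrib, sum_add_distrib, sum_ite_eq, sum_ite_eq, ← mul_sum]
  have h1 : (if 1 ∈ Icc 1 D then exp 1 * τ * (ι₁ * lam) else 0) ≤ exp 1 * τ * (ι₁ * lam) := by
    split_ifs
    · exact le_rfl
    · positivity
  have h2 : (if 2 ∈ Icc 1 D then (exp 1 * τ) ^ 2 * (ι₂ * lam) else 0) ≤ (exp 1 * τ) ^ 2 * (ι₂ * lam) := by
    split_ifs
    · exact le_rfl
    · positivity
  exact add_le_add_three h1 h2 (mul_le_mul_of_nonneg_left (sum_Icc_ite_pow_le hx0 hx₃ D) (by positivity))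

/-- **First order with the profile only above degree two**: for `3 ≤ p`, `towerFO D σ μ p` reads `μ` in degrees `m > p ≥ 3` only, so the recursive
profile `μ m ≤ A'λ^{m−1}Q'^m` (`3 ≤ m`) suffices: `towerFO D σ μ p ≤ A'λ^{p−1}(4Q')^p·x₁/(1−x₁)`. -/
theorem towerFO_le_of_three_le {D : ℕ} {σ A' lam Q' : ℝ} {μ : ℕ → ℝ} (hσ : 0 ≤ σ) (hA' : 0 ≤ A') (hlam : 0 ≤ lam) (hQ' : 0 ≤ Q')
    (hμ0 : ∀ m, 0 ≤ μ m) (hprof : ∀ m, 3 ≤ m → m ≤ D → μ m ≤ A' * lam ^ (m - 1) * Q' ^ m)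
    (hx₁ : 4 * σ * lam * Q' < 1) {p : ℕ} (hp : 3 ≤ p) :
    towerFO D σ μ p ≤ A' * lam ^ (p - 1) * (4 * Q') ^ p * (4 * σ * lam * Q' / (1 - 4 * σ * lam * Q')) := by
  set μ' : ℕ → ℝ := fun m => if 3 ≤ m then μ m else 0 with hμ'
  have hμ'0 : ∀ m, 0 ≤ μ' m := fun m => by rw [hμ']; dsimp only; split_ifs; exacts [hμ0 m, le_rfl]
  have hprof' : ∀ m, 1 ≤ m → m ≤ D → μ' m ≤ A' * lam ^ (m - 1) * Q' ^ m := fun m _ hmD => by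
    rw [hμ']; dsimp only; split_ifs with h3
    · exact hprof m h3 hmD
    · positivity
  have heq : towerFO D σ μ p = towerFO D σ μ' p := by
    unfold towerFO
    refine sum_congr rfl fun m hm => ?_
    rw [hμ']; dsimp only
    rw [if_pos (by have := (mem_Ioc.1 hm).1; omega)]
  rw [heq]
  exact towerFO_le hσ hA' hlam hQ' hμ'0 hprof' hx₁ (by omega)

/-! ## §3 (T2♯) The block step in closed form, three-piece profile -/

/-- **(T2♯) The block step for the three-piece profile, in closed form** (inputs `μ 1 ≤ ι₁λ`, `μ 2 ≤ ι₂λ`, `μ m ≤ A'λ^{m−1}Q'^m` for `m ≥ 3`;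
the suppliers' step hypothesis ∀ N ≥ 2 under the guard `ΦV < 1`; smallness `x₁ < 1`, `2λτQ' ≤ 1`, `x₃ < 1`, `y = Φτ(ι₁λ + ι₂/(2Q') + A'Q'/2) < 1`,
`θ̄ < 1`): for `3 ≤ p`, `b ≤ A'λ^{p−1}(4Q')^p·x₁/(1−x₁) + e·λ^{p−1}·ψ·(2τψQ')^{p−1}·τ(ι₁λ + ι₂/(2Q') + A'Q'/2)·y/(1−y)`. -/
theorem towerStep_le_profile₃ {D : ℕ} {μ : ℕ → ℝ} {b σ Φ ψ τ A' lam Q' ι₁ ι₂ : ℝ}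
    (hσ : 0 ≤ σ) (hΦ : 0 ≤ Φ) (hψ : 0 ≤ ψ) (hτ : 0 < τ) (hA' : 0 ≤ A') (hlam : 0 < lam) (hQ' : 0 < Q')
    (hμ0 : ∀ m, 0 ≤ μ m) (hι₁ : μ 1 ≤ ι₁ * lam) (hι₂ : μ 2 ≤ ι₂ * lam)
    (hprof : ∀ m, 3 ≤ m → m ≤ D → μ m ≤ A' * lam ^ (m - 1) * Q' ^ m)
    (hx₁ : 4 * σ * lam * Q' < 1) (hx₂ : 2 * lam * τ * Q' ≤ 1) (hx₃ : exp 1 * τ * lam * Q' < 1)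
    (hy : Φ * τ * (ι₁ * lam + ι₂ / (2 * Q') + A' * Q' / 2) < 1)
    (hθ : Φ * (exp 1 * τ * (ι₁ * lam) + (exp 1 * τ) ^ 2 * (ι₂ * lam) +
      A' * (exp 1 * τ * Q') * ((exp 1 * τ * lam * Q') ^ 2 / (1 - exp 1 * τ * lam * Q'))) < 1)
    {p : ℕ} (hp : 3 ≤ p)
    (hstep : ∀ N : ℕ, 2 ≤ N → Φ * towerV D τ μ < 1 →
      b ≤ towerFO D σ μ p + ∑ n ∈ Icc 2 N, exp 1 * Φ ^ (n - 1) * ψ ^ p * towerS D τ μ n p +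
        ψ ^ p * exp 1 * towerV D τ μ * (Φ * towerV D τ μ) ^ N / (1 - Φ * towerV D τ μ)) :
    b ≤ A' * lam ^ (p - 1) * (4 * Q') ^ p * (4 * σ * lam * Q' / (1 - 4 * σ * lam * Q')) +
      exp 1 * lam ^ (p - 1) * ψ * (2 * τ * ψ * Q') ^ (p - 1) * (τ * (ι₁ * lam + ι₂ / (2 * Q') + A' * Q' / 2)) *
        (Φ * τ * (ι₁ * lam + ι₂ / (2 * Q') + A' * Q' / 2) / (1 - Φ * τ * (ι₁ * lam + ι₂ / (2 * Q') + A' * Q' / 2))) := by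
  set V := towerV D τ μ with hVdef
  set Vb := exp 1 * τ * (ι₁ * lam) + (exp 1 * τ) ^ 2 * (ι₂ * lam) +
    A' * (exp 1 * τ * Q') * ((exp 1 * τ * lam * Q') ^ 2 / (1 - exp 1 * τ * lam * Q')) with hVb
  have hV0 : 0 ≤ V := towerV_nonneg hτ.le hμ0
  have hVle : V ≤ Vb := towerV_le_threePiece hτ.le hlam.le hQ'.le hA' hμ0 hι₁ hι₂ hprof hx₃
  have hθ0 : 0 ≤ Φ * V := mul_nonneg hΦ hV0
  have hθle : Φ * V ≤ Φ * Vb := mul_le_mul_of_nonneg_left hVle hΦ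
  have hθ1 : Φ * V < 1 := hθle.trans_lt hθ
  have hθb0 : 0 ≤ Φ * Vb := hθ0.trans hθle
  set Y := ι₁ * lam + ι₂ / (2 * Q') + A' * Q' / 2 with hYdef
  set y := Φ * τ * Y with hydef
  have hSum := sum_threePiece_le (D := D) hτ hlam hQ' hA' hμ0 hι₁ hι₂ hprof
  have hSum0 : 0 ≤ ∑ δ ∈ Icc 1 D, τ ^ δ * μ δ * ((2 * τ * Q' * lam)⁻¹) ^ (δ - 1) :=
    sum_nonneg fun δ _ => by have := hμ0 δ; positivity
  have hY0 : 0 ≤ τ * Y := hSum0.trans hSum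
  have hY0' : 0 ≤ Y := (mul_nonneg_iff_of_pos_left hτ).1 hY0
  have hy0 : 0 ≤ y := by rw [hydef]; positivity
  have hw : 1 ≤ (2 * τ * Q' * lam)⁻¹ := (one_le_inv₀ (by positivity)).2 (by linarith)
  set F := A' * lam ^ (p - 1) * (4 * Q') ^ p * (4 * σ * lam * Q' / (1 - 4 * σ * lam * Q')) with hF
  set M := exp 1 * lam ^ (p - 1) * ψ * (2 * τ * ψ * Q') ^ (p - 1) * (τ * Y) with hM
  have hM0 : 0 ≤ M := by positivity
  set T : ℕ → ℝ := fun N => ψ ^ p * exp 1 * Vb * (Φ * Vb) ^ N / (1 - Φ * Vb) with hT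
  -- graded partial sums
  have hG : ∀ N, ∑ n ∈ Icc 2 N, exp 1 * Φ ^ (n - 1) * ψ ^ p * towerS D τ μ n p ≤ M * (y / (1 - y)) := by
    intro N
    have hterm : ∀ n ∈ Icc 2 N, exp 1 * Φ ^ (n - 1) * ψ ^ p * towerS D τ μ n p ≤ M * y ^ (n - 1) := by
      intro n hn
      have hn1 : 1 ≤ n := by have := (mem_Icc.1 hn).1; omega
      have hS := towerS_le_chernoff (D := D) hτ.le hμ0 hw n p
      have hpow : (∑ δ ∈ Icc 1 D, τ ^ δ * μ δ * ((2 * τ * Q' * lam)⁻¹) ^ (δ - 1)) ^ n ≤ (τ * Y) ^ n :=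
        pow_le_pow_left₀ hSum0 hSum n
      have hinv : (((2 * τ * Q' * lam)⁻¹) ^ (p - 1))⁻¹ = (2 * τ * Q' * lam) ^ (p - 1) := by rw [inv_pow, inv_inv]
      rw [hinv] at hS
      calc exp 1 * Φ ^ (n - 1) * ψ ^ p * towerS D τ μ n p
          ≤ exp 1 * Φ ^ (n - 1) * ψ ^ p * ((2 * τ * Q' * lam) ^ (p - 1) * (τ * Y) ^ n) := by
            have := towerS_nonneg hτ.le hμ0 n p (D := D)
            have h2 : towerS D τ μ n p ≤ (2 * τ * Q' * lam) ^ (p - 1) * (τ * Y) ^ n :=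
              hS.trans (mul_le_mul_of_nonneg_left hpow (by positivity))
            gcongr
        _ = M * y ^ (n - 1) := by
            rw [hM, hydef]
            obtain ⟨j, rfl⟩ : ∃ j, n = j + 1 := ⟨n - 1, by omega⟩
            obtain ⟨q, rfl⟩ : ∃ q, p = q + 1 := ⟨p - 1, by omega⟩
            simp only [Nat.add_sub_cancel, pow_succ, mul_pow]
            ring
    refine (sum_le_sum hterm).trans ?_
    rw [← mul_sum]
    exact mul_le_mul_of_nonneg_left (sum_Icc_two_pow_sub_one_le hy0 hy N) hM0
  -- the tail, monotone in `V`
  have hTail : ∀ N, ψ ^ p * exp 1 * V * (Φ * V) ^ N / (1 - Φ * V) ≤ T N := by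
    intro N
    have h1 : 0 < 1 - Φ * Vb := sub_pos.2 hθ
    have h2 : 1 - Φ * Vb ≤ 1 - Φ * V := by linarith
    rw [hT]
    dsimp only
    rw [div_eq_mul_inv, div_eq_mul_inv]
    have hinv : (1 - Φ * V)⁻¹ ≤ (1 - Φ * Vb)⁻¹ := inv_anti₀ h1 h2
    have hpowN : (Φ * V) ^ N ≤ (Φ * Vb) ^ N := pow_le_pow_left₀ hθ0 hθle N
    have : 0 ≤ (1 - Φ * V)⁻¹ := inv_nonneg.2 (sub_nonneg.2 hθ1.le)
    have hVb0 : 0 ≤ Vb := hV0.trans hVle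
    gcongr
  -- every `N ≥ 2`
  have hFO := towerFO_le_of_three_le hσ hA' hlam.le hQ'.le hμ0 hprof hx₁ hp (D := D)
  have hbN : ∀ N, 2 ≤ N → b ≤ F + M * (y / (1 - y)) + T N := fun N hN =>
    (hstep N hN hθ1).trans (add_le_add_three hFO (hG N) (hTail N))
  -- `T N → 0`
  have hTto : Filter.Tendsto T Filter.atTop (nhds 0) := by
    have h := (tendsto_pow_atTop_nhds_zero_of_lt_one hθb0 hθ).mul_const ((1 - Φ * Vb)⁻¹) |>.const_mul (ψ ^ p * exp 1 * Vb)
    rw [zero_mul, mul_zero] at h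
    refine h.congr' (Filter.Eventually.of_forall fun N => ?_)
    rw [hT]
    dsimp only
    rw [div_eq_mul_inv]
    ring
  have hlim : Filter.Tendsto (fun N => F + M * (y / (1 - y)) + T N) Filter.atTop (nhds (F + M * (y / (1 - y)))) := by
    have := hTto.const_add (F + M * (y / (1 - y)))
    rwa [add_zero] at this
  exact ge_of_tendsto hlim (Filter.eventually_atTop.2 ⟨2, fun N hN => hbN N hN⟩)

/-! ## §4 (T3♯) The induction over blocks, imports carrying their `ε` -/

/-- **(T3♯) The blocked birth-level tower closes — sharp form** (as `towerBorn_le_law`, with the imports at their honest size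
`μ k 1 ≤ ι₁λ`, `μ k 2 ≤ ι₂λ`; numerics: `x₁ < 1`, `2λτQ' ≤ 1`, `x₃ < 1`, `y < 1`, `θ̄ < 1`, BLOCKING `4Q' ≤ Q`, `2τψQ' ≤ Q`, and the closing
inequality at `p = 3`): `∀ k ≤ K, ∀ 3 ≤ p ≤ D, b k p ≤ A λ^{p−1} Q^p`. -/
theorem towerBorn_le_law₃ {D K : ℕ} {b μ : ℕ → ℕ → ℝ} {A lam Q g c₁ c₂ σ Φ ψ τ A' Q' ι₁ ι₂ : ℝ}
    (hA : 0 ≤ A) (hlam : 0 < lam) (hQ : 0 ≤ Q) (hg0 : 0 < g) (hg1 : g < 1) (hc₁ : 0 ≤ c₁) (hc₂ : 0 ≤ c₂)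
    (hσ : 0 ≤ σ) (hΦ : 0 ≤ Φ) (hψ : 0 ≤ ψ) (hτ : 0 < τ) (hQ'0 : 0 < Q') (hA'ge : c₁ * A / ((1 - g) * g ^ 2) ≤ A') (hQ'ge : c₂ * g * Q ≤ Q')
    (hb0 : ∀ k m, 0 ≤ b k m) (hμ0 : ∀ k m, 0 ≤ μ k m)
    (h0 : ∀ p, 3 ≤ p → p ≤ D → b 0 p ≤ A * lam ^ (p - 1) * Q ^ p)
    (hμ : ∀ k < K, ∀ m, 3 ≤ m → m ≤ D →
      μ k m ≤ ∑ k' ∈ range (k + 1), c₁ * c₂ ^ m * g ^ ((m - 2) * (k + 1 - k')) * b k' m)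
    (hι₁ : ∀ k < K, μ k 1 ≤ ι₁ * lam) (hι₂ : ∀ k < K, μ k 2 ≤ ι₂ * lam)
    (hstep : ∀ k < K, ∀ N : ℕ, 2 ≤ N → ∀ p, 3 ≤ p → p ≤ D → Φ * towerV D τ (μ k) < 1 →
      b (k + 1) p ≤ towerFO D σ (μ k) p + ∑ n ∈ Icc 2 N, exp 1 * Φ ^ (n - 1) * ψ ^ p * towerS D τ (μ k) n p +
        ψ ^ p * exp 1 * towerV D τ (μ k) * (Φ * towerV D τ (μ k)) ^ N / (1 - Φ * towerV D τ (μ k)))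
    (hx₁ : 4 * σ * lam * Q' < 1) (hx₂ : 2 * lam * τ * Q' ≤ 1) (hx₃ : exp 1 * τ * lam * Q' < 1)
    (hy : Φ * τ * (ι₁ * lam + ι₂ / (2 * Q') + A' * Q' / 2) < 1)
    (hθ : Φ * (exp 1 * τ * (ι₁ * lam) + (exp 1 * τ) ^ 2 * (ι₂ * lam) +
      A' * (exp 1 * τ * Q') * ((exp 1 * τ * lam * Q') ^ 2 / (1 - exp 1 * τ * lam * Q'))) < 1)
    (hu₁ : 4 * Q' ≤ Q) (hu₂ : 2 * τ * ψ * Q' ≤ Q)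
    (hclose : A' * (4 * Q') ^ 3 * (4 * σ * lam * Q' / (1 - 4 * σ * lam * Q')) +
      exp 1 * ψ * (2 * τ * ψ * Q') ^ 2 * (τ * (ι₁ * lam + ι₂ / (2 * Q') + A' * Q' / 2)) *
        (Φ * τ * (ι₁ * lam + ι₂ / (2 * Q') + A' * Q' / 2) / (1 - Φ * τ * (ι₁ * lam + ι₂ / (2 * Q') + A' * Q' / 2))) ≤ A * Q ^ 3) :
    ∀ k ≤ K, ∀ p, 3 ≤ p → p ≤ D → b k p ≤ A * lam ^ (p - 1) * Q ^ p := by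
  have hg1' : 0 < 1 - g := sub_pos.2 hg1
  have hA'0 : 0 ≤ A' := le_trans (by positivity) hA'ge
  have hx10 : 0 ≤ 4 * σ * lam * Q' / (1 - 4 * σ * lam * Q') := div_nonneg (by positivity) (sub_nonneg.2 hx₁.le)
  suffices H : ∀ k ≤ K, ∀ k' ≤ k, ∀ p, 3 ≤ p → p ≤ D → b k' p ≤ A * lam ^ (p - 1) * Q ^ p from
    fun k hk p hp hpD => H k hk k le_rfl p hp hpD
  intro k
  induction k with
  | zero => intro _ k' hk' p hp hpD; rw [Nat.le_zero.1 hk']; exact h0 p hp hpD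
  | succ k ih =>
    intro hk1 k' hk' p hp hpD
    have hkK : k < K := Nat.lt_of_succ_le hk1
    have ih' := ih (Nat.le_of_succ_le hk1)
    rcases Nat.lt_succ_iff_lt_or_eq.1 (Nat.lt_succ_of_le hk') with hlt | rfl
    · exact ih' k' (Nat.lt_succ_iff.1 hlt) p hp hpD
    · -- inputs: the recursive profile from T1, the imports from `hι₁`, `hι₂`
      have hprof : ∀ m, 3 ≤ m → m ≤ D → μ k m ≤ A' * lam ^ (m - 1) * Q' ^ m := by
        intro m hm3 hmD
        have hT1 := towerMeasured_le_profile (D := D) hA hlam.le hQ hg0 hg1 hc₁ hc₂ hb0 (hμ k hkK) ih' hm3 hmD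
        refine hT1.trans ?_
        have : 0 ≤ c₁ * A / ((1 - g) * g ^ 2) := by positivity
        have : 0 ≤ c₂ * g * Q := by positivity
        gcongr
      -- the Chernoff data are nonnegative
      have hY0 : 0 ≤ τ * (ι₁ * lam + ι₂ / (2 * Q') + A' * Q' / 2) :=
        (sum_nonneg fun δ _ => by have := hμ0 k δ; positivity).trans
          (sum_threePiece_le (D := D) hτ hlam hQ'0 hA'0 (hμ0 k) (hι₁ k hkK) (hι₂ k hkK) hprof)
      have hY0' : 0 ≤ ι₁ * lam + ι₂ / (2 * Q') + A' * Q' / 2 := (mul_nonneg_iff_of_pos_left hτ).1 hY0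
      have hyq0 : 0 ≤ Φ * τ * (ι₁ * lam + ι₂ / (2 * Q') + A' * Q' / 2) /
          (1 - Φ * τ * (ι₁ * lam + ι₂ / (2 * Q') + A' * Q' / 2)) := div_nonneg (by positivity) (sub_nonneg.2 hy.le)
      have hT2 := towerStep_le_profile₃ (D := D) hσ hΦ hψ hτ hA'0 hlam hQ'0 (hμ0 k) (hι₁ k hkK) (hι₂ k hkK) hprof hx₁ hx₂ hx₃ hy hθ
        (p := p) hp (fun N hN hguard => hstep k hkK N hN p hp hpD hguard)
      refine hT2.trans ?_
      -- close: `(4Q')^p ≤ (4Q')^3 Q^{p-3}`, `(2τψQ')^{p-1} ≤ (2τψQ')^2 Q^{p-3}`, then the closing inequality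
      obtain ⟨r, rfl⟩ : ∃ r, p = 3 + r := ⟨p - 3, by omega⟩
      have h4 : (4 * Q') ^ (3 + r) ≤ (4 * Q') ^ 3 * Q ^ r := by
        rw [pow_add]; exact mul_le_mul_of_nonneg_left (pow_le_pow_left₀ (by positivity) hu₁ r) (by positivity)
      have h2 : (2 * τ * ψ * Q') ^ (3 + r - 1) ≤ (2 * τ * ψ * Q') ^ 2 * Q ^ r := by
        rw [show 3 + r - 1 = 2 + r by omega, pow_add]
        exact mul_le_mul_of_nonneg_left (pow_le_pow_left₀ (by positivity) hu₂ r) (by positivity)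
      set Y := ι₁ * lam + ι₂ / (2 * Q') + A' * Q' / 2 with hY
      set X₁ := 4 * σ * lam * Q' / (1 - 4 * σ * lam * Q') with hX₁
      set Z := Φ * τ * Y / (1 - Φ * τ * Y) with hZ
      calc A' * lam ^ (3 + r - 1) * (4 * Q') ^ (3 + r) * X₁ + exp 1 * lam ^ (3 + r - 1) * ψ * (2 * τ * ψ * Q') ^ (3 + r - 1) * (τ * Y) * Z
          ≤ A' * lam ^ (3 + r - 1) * ((4 * Q') ^ 3 * Q ^ r) * X₁ +
              exp 1 * lam ^ (3 + r - 1) * ψ * ((2 * τ * ψ * Q') ^ 2 * Q ^ r) * (τ * Y) * Z := by gcongr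
        _ = lam ^ (3 + r - 1) * Q ^ r * (A' * (4 * Q') ^ 3 * X₁ + exp 1 * ψ * (2 * τ * ψ * Q') ^ 2 * (τ * Y) * Z) := by ring
        _ ≤ lam ^ (3 + r - 1) * Q ^ r * (A * Q ^ 3) := mul_le_mul_of_nonneg_left hclose (by positivity)
        _ = A * lam ^ (3 + r - 1) * Q ^ (3 + r) := by rw [pow_add]; ring

end Summit.HubbardSuperconductivity.HubbardSuperconductivity.Theorems.EngineV8

end
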